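import Literature.NumberTheory.Automorphic.AdelicPiSchwartzBruhatFourier      -- ★ `adeleAddChar_eq_mul`∕`adeleAddChar_infiniteAdeleInl`, `finiteAdeleAddChar`, level lemmas, adele instances
import HarnessLib

/-!
# h413 ∕ Track B «K2-LIT», page EIS-RANK-ONE, rung R6d — `K2E1AdelicFourierEnvelope`: the adelic Fourier transform of a TENSOR `Φ = Φ_∞ ⊗ Φ_f` with `Φ_f` of LEVEL `𝔫`
# lies in the decay class of ★ `K2E1AdelicFourierDecay` (archimedean decay = that of `𝓕_∞Φ_∞`, finite support ⊆ a compact determined by `𝔫` alone) — number-field generic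

Cell `pub/hodgecm-mathlib`, crux H413 = `stmt-HodgeConjecture-24833` (supports-only helper, count-neutral), route `HCCMUnconditional`; dealer K2E1-plan (g3), deal
(D1-b) 2026-09-04T05:35:14Z → K2E4-p10 (g3); REPORT-FIRST 05:41Z.  THEOREMS ONLY (no `def`, no `instance`, no `notation`, no named-fact hypothesis, no `sorry`).

## The statement (head of record `exists_envelope`, FIBREWISE — dealer's ruling «R6d-FIBREWISE» 05:44Z; tensor corollary `exists_envelope_of_tensor`)

`K` a number field, `𝔸 = 𝔸_K = K_∞ × 𝔸_K^∞` (Mathlib's `AdeleRing (𝓞 K) K`, a product type), `ψ = adeleAddChar K` Tate's character, `ψ(x) = ψ(x_∞, 0)·ψ_f(x_f)`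
(★ `adeleAddChar_eq_mul`).  Additive Haar measures `μ` on `𝔸`, `μ₁` on `K_∞`, `μ₂` on `𝔸_K^∞`.  THEN: there is `c > 0` (measures only, §1) and, for every level `𝔫 ≠ 0`,
a COMPACT `Cf ⊆ 𝔸_K^∞` (level only, §3) such that for every `Φ : 𝔸 → ℂ`, `A : 𝔸_K^∞ → ℝ`, `N₂ : ℝ`, `m : ℕ` with
  (i)    `(a, b) ↦ Φ(a, b)` integrable for `μ₁ ⊗ μ₂` (⟺ `Φ ∈ L¹(𝔸, μ)`, `integrable_iff_integrable_prod`),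
  (ii)   `Φ(a, b + l) = Φ(a, b)` for `l ∈ 𝔫𝒪̂_K` (★ `levelIdeal K 𝔫`) — level-`𝔫` periodicity in the finite variable,
  (iii″) FIBREWISE archimedean Fourier decay `‖∫ Φ(a, b) ψ((y a, 0)) dμ₁(a)‖ ≤ A(b) (1 + ‖y‖)^{-m}` (norm of `y` read in the mixed space), `A ∈ L¹(μ₂)`, `∫ A dμ₂ ≤ N₂`,
the adelic Fourier transform `Ψ(η) = ∫ Φ(v) ψ(η v) dμ(v)` satisfies EXACTLY the two binders of ★ `K2E1AdelicFourierDecay` (E2):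
  `hM : ∀ η, ‖Ψ η‖ ≤ (c N₂) (1 + ‖η_∞‖)^{-m}`   and   `hCf : ∀ η, η_f ∉ Cf → Ψ η = 0`,
constants uniform over the class {same `𝔫`, `N₂`, `m`} — the uniformity in `k ∈ K_U` the Maass–Selberg page needs.  (iii″) is hypothesis-first: the calculus lemma
«`C^m` in `a` with `L¹` derivatives ⟹ (iii″)» is a separate generic file; consumers with an explicit archimedean factor may verify (iii″) directly.

## Proof

§1 `μ = c·(μ₁ ⊗ μ₂)` (uniqueness of Haar measure on the second countable locally compact `𝔸`; integrability transfers); §2 for a tensor the transform FACTORS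
(★ character split + Mathlib `integral_prod_mul`), `‖𝓕_fΦ₂‖ ≤ ∫‖Φ₂‖`; §3 LEVEL ⟹ COMPACT SUPPORT of a finite transform, uniformly over the level class: translation
covariance `𝓕_fG(y) = ψ_f(y l) 𝓕_fG(y)` (`l ∈ 𝔫𝒪̂_K`), so `𝓕_fG(y) ≠ 0` forces `ψ_f(y·𝔫𝒪̂_K) = 1`, whence `D c y ∈ 𝒪̂_K` (★ `exists_denominator_annihilator_levelIdeal`) and `y` lies
in the compact `(Dc)⁻¹𝒪̂_K` (★ `isCompact_integralFiniteAdeles`); §4 FIBREWISE: `Ψ(η) = c ∫_{𝔸_f} ψ_f(η_f b)·G_η(b) dμ₂(b)` with `G_η(b) = ∫_{K_∞} Φ(a,b) ψ((η_∞ a, 0)) dμ₁(a)` (Fubini),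
so `‖Ψ(η)‖ ≤ c ∫ A · (1+‖η_∞‖)^{-m}` and `G_η` inherits the level, §3 applies; §5 the tensor corollary.

HONEST LABEL.  Count-neutral helper; proves no printed statement; HC_CM is proved only modulo the 7 printed citations (2 remaining named inputs: hLiu418 =
`stmt-HodgeConjecture-24832`, h413 = `stmt-HodgeConjecture-24833`) until rung 0 closes.

## References
* [CasselsFrohlichANT1967] J. Tate, *Fourier analysis in number fields and Hecke's zeta-functions*, Ch. XV of Cassels–Fröhlich (1967), §2.2 (local `ψ_v`, conductors),
  §3.2–3.3 (`dx = ∏ dx_v`, transforms of standard functions), §4.1.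
* [WeilBNT1967] A. Weil, *Basic Number Theory* (1967), Ch. VII §2 (standard functions and their transforms).
* [MoeglinWaldspurger1995] C. Mœglin, J.-L. Waldspurger, *Spectral decomposition and Eisenstein series* (1995), II.1.10 (Fourier expansion of `E − E_P`).
-/

set_option autoImplicit false
set_option linter.dupNamespace false  -- the mandated namespace repeats the summit's segment (`HodgeConjecture.HodgeConjecture`)

noncomputable section

open scoped NNReal ENNReal Classical
open MeasureTheory MeasureTheory.Measure NumberField NumberField.mixedEmbedding IsDedekindDomain Set
open Literature.NumberTheory.Automorphic

namespace Summit.HodgeConjecture.HodgeConjecture.Cruxes.H413.K2E1AdelicFourierEnvelope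

variable (K : Type) [Field K] [NumberField K]
  [MeasurableSpace (AdeleRing (𝓞 K) K)] [BorelSpace (AdeleRing (𝓞 K) K)]
  [MeasurableSpace (InfiniteAdeleRing K)] [BorelSpace (InfiniteAdeleRing K)]
  [MeasurableSpace (FiniteAdeleRing (𝓞 K) K)] [BorelSpace (FiniteAdeleRing (𝓞 K) K)]

/-! ## §1 Haar measure on `𝔸_K = K_∞ × 𝔸_K^∞` is a product -/

/-- **`μ = c·(μ₁ ⊗ μ₂)` on `𝔸_K = K_∞ × 𝔸_K^∞`**: for additive Haar measures `μ`, `μ₁`, `μ₂` there is `c > 0` with `∫_𝔸 G dμ = c ∫∫ G(a, b) dμ₁(a) dμ₂(b)` for every `G`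
(uniqueness of Haar measure; Tate's `dx = ∏_v dx_v`). [cite: CasselsFrohlichANT1967, Ch. XV §3.3] -/
theorem exists_integral_adele_eq_smul_integral_prod (μ : Measure (AdeleRing (𝓞 K) K)) [μ.IsAddHaarMeasure]
    (μ₁ : Measure (InfiniteAdeleRing K)) [μ₁.IsAddHaarMeasure] (μ₂ : Measure (FiniteAdeleRing (𝓞 K) K)) [μ₂.IsAddHaarMeasure] :
    ∃ c : ℝ≥0, 0 < c ∧ ∀ G : InfiniteAdeleRing K → FiniteAdeleRing (𝓞 K) K → ℂ,
      ∫ v, G v.1 v.2 ∂μ = (c : ℝ) • ∫ p : InfiniteAdeleRing K × FiniteAdeleRing (𝓞 K) K, G p.1 p.2 ∂(μ₁.prod μ₂) := by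
  haveI := secondCountableTopology_adeleRing K
  haveI := locallyCompactSpace_adeleRing' K
  haveI := secondCountableTopology_finiteAdeleRing K
  haveI := locallyCompactSpace_finiteAdeleRing' K
  haveI := secondCountableTopology_infiniteAdeleRing K
  haveI : BorelSpace (InfiniteAdeleRing K × FiniteAdeleRing (𝓞 K) K) := Prod.borelSpace
  -- the identity `K_∞ × 𝔸_K^∞ ≃+ 𝔸_K` (Mathlib's `AdeleRing` IS this product)
  let e : InfiniteAdeleRing K × FiniteAdeleRing (𝓞 K) K ≃+ AdeleRing (𝓞 K) K := AddEquiv.refl _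
  have he : Continuous e := continuous_id
  have hes : Continuous e.symm := continuous_id
  haveI : (μ₁.prod μ₂).IsAddHaarMeasure := Measure.prod.instIsAddHaarMeasure μ₁ μ₂
  haveI : ((μ₁.prod μ₂).map e).IsAddHaarMeasure := AddEquiv.isAddHaarMeasure_map _ e he hes
  refine ⟨μ.addHaarScalarFactor ((μ₁.prod μ₂).map e), addHaarScalarFactor_pos_of_isAddHaarMeasure _ _, fun G => ?_⟩
  have hμ : μ = μ.addHaarScalarFactor ((μ₁.prod μ₂).map e) • (μ₁.prod μ₂).map e := isAddLeftInvariant_eq_smul _ _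
  conv_lhs => rw [hμ]
  rw [integral_smul_nnreal_measure, NNReal.smul_def]
  congr 1
  have hme : MeasurableEmbedding e := (Homeomorph.mk e.toEquiv he hes).measurableEmbedding
  rw [hme.integral_map]
  rfl

/-- **Integrability transfers** along `μ = c·(μ₁ ⊗ μ₂)`: `Φ ∈ L¹(𝔸, μ)` iff `(a, b) ↦ Φ(a, b) ∈ L¹(μ₁ ⊗ μ₂)`. [cite: CasselsFrohlichANT1967, Ch. XV §3.3] -/
theorem integrable_iff_integrable_prod (μ : Measure (AdeleRing (𝓞 K) K)) [μ.IsAddHaarMeasure]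
    (μ₁ : Measure (InfiniteAdeleRing K)) [μ₁.IsAddHaarMeasure] (μ₂ : Measure (FiniteAdeleRing (𝓞 K) K)) [μ₂.IsAddHaarMeasure]
    (Φ : AdeleRing (𝓞 K) K → ℂ) :
    Integrable Φ μ ↔ Integrable (fun p : InfiniteAdeleRing K × FiniteAdeleRing (𝓞 K) K => Φ (p.1, p.2)) (μ₁.prod μ₂) := by
  haveI := secondCountableTopology_adeleRing K
  haveI := locallyCompactSpace_adeleRing' K
  haveI := secondCountableTopology_finiteAdeleRing K
  haveI := locallyCompactSpace_finiteAdeleRing' K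
  haveI := secondCountableTopology_infiniteAdeleRing K
  haveI : BorelSpace (InfiniteAdeleRing K × FiniteAdeleRing (𝓞 K) K) := Prod.borelSpace
  let e : InfiniteAdeleRing K × FiniteAdeleRing (𝓞 K) K ≃+ AdeleRing (𝓞 K) K := AddEquiv.refl _
  have he : Continuous e := continuous_id
  have hes : Continuous e.symm := continuous_id
  haveI : (μ₁.prod μ₂).IsAddHaarMeasure := Measure.prod.instIsAddHaarMeasure μ₁ μ₂
  haveI : ((μ₁.prod μ₂).map e).IsAddHaarMeasure := AddEquiv.isAddHaarMeasure_map _ e he hes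
  have hμ : μ = μ.addHaarScalarFactor ((μ₁.prod μ₂).map e) • (μ₁.prod μ₂).map e := isAddLeftInvariant_eq_smul _ _
  have hc0 : μ.addHaarScalarFactor ((μ₁.prod μ₂).map e) ≠ 0 := (addHaarScalarFactor_pos_of_isAddHaarMeasure _ _).ne'
  have hme : MeasurableEmbedding e := (Homeomorph.mk e.toEquiv he hes).measurableEmbedding
  conv_lhs => rw [hμ]
  rw [ENNReal.smul_def, integrable_smul_measure (by simpa using hc0) ENNReal.coe_ne_top, hme.integrable_map_iff]
  exact Iff.rfl

/-! ## §2 The transform of a tensor factors -/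

omit [BorelSpace (AdeleRing (𝓞 K) K)] [BorelSpace (InfiniteAdeleRing K)] [BorelSpace (FiniteAdeleRing (𝓞 K) K)] in
/-- **`𝓕(Φ_∞ ⊗ Φ_f)(η) = c · 𝓕_∞Φ_∞(η_∞) · 𝓕_fΦ_f(η_f)`**: under `∫_𝔸 = c ∫∫` (§1), for `Φ(v) = Φ₁(v_∞) Φ₂(v_f)` and Tate's character `ψ(x) = ψ(x_∞, 0) ψ_f(x_f)`
(★ `adeleAddChar_eq_mul`), the adelic transform is `c` times the product of the archimedean and the finite transforms (Mathlib `integral_prod_mul`, no integrability needed).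
[cite: CasselsFrohlichANT1967, Ch. XV §3.3] -/
theorem integral_tensor_mul_adeleAddChar_eq {μ : Measure (AdeleRing (𝓞 K) K)} {μ₁ : Measure (InfiniteAdeleRing K)} {μ₂ : Measure (FiniteAdeleRing (𝓞 K) K)}
    [SFinite μ₁] [SFinite μ₂] {c : ℝ≥0}
    (hc : ∀ G : InfiniteAdeleRing K → FiniteAdeleRing (𝓞 K) K → ℂ,
      ∫ v, G v.1 v.2 ∂μ = (c : ℝ) • ∫ p : InfiniteAdeleRing K × FiniteAdeleRing (𝓞 K) K, G p.1 p.2 ∂(μ₁.prod μ₂))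
    {Φ : AdeleRing (𝓞 K) K → ℂ} {Φ₁ : InfiniteAdeleRing K → ℂ} {Φ₂ : FiniteAdeleRing (𝓞 K) K → ℂ} (hΦ : ∀ v, Φ v = Φ₁ v.1 * Φ₂ v.2)
    (η : AdeleRing (𝓞 K) K) :
    ∫ v, Φ v * (adeleAddChar K (η * v) : ℂ) ∂μ =
      (c : ℂ) * (∫ a, Φ₁ a * (adeleAddChar K (infiniteAdeleInl K (η.1 * a)) : ℂ) ∂μ₁) * (∫ b, Φ₂ b * (finiteAdeleAddChar K (η.2 * b) : ℂ) ∂μ₂) := by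
  have hmul1 : ∀ v : AdeleRing (𝓞 K) K, (η * v).1 = η.1 * v.1 := fun v => rfl
  have hmul2 : ∀ v : AdeleRing (𝓞 K) K, (η * v).2 = η.2 * v.2 := fun v => rfl
  -- split the integrand on `𝔸`
  have hint : ∀ v : AdeleRing (𝓞 K) K, Φ v * (adeleAddChar K (η * v) : ℂ) =
      (Φ₁ v.1 * (adeleAddChar K (infiniteAdeleInl K (η.1 * v.1)) : ℂ)) * (Φ₂ v.2 * (finiteAdeleAddChar K (η.2 * v.2) : ℂ)) := by
    intro v
    rw [hΦ, adeleAddChar_eq_mul K (η * v), Circle.coe_mul, hmul1, hmul2]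
    ring
  simp_rw [hint]
  have h := hc (fun a b => (Φ₁ a * (adeleAddChar K (infiniteAdeleInl K (η.1 * a)) : ℂ)) * (Φ₂ b * (finiteAdeleAddChar K (η.2 * b) : ℂ)))
  rw [h, Complex.real_smul, mul_assoc]
  congr 1
  exact integral_prod_mul (fun a => Φ₁ a * (adeleAddChar K (infiniteAdeleInl K (η.1 * a)) : ℂ)) (fun b => Φ₂ b * (finiteAdeleAddChar K (η.2 * b) : ℂ))

omit [MeasurableSpace (AdeleRing (𝓞 K) K)] [BorelSpace (AdeleRing (𝓞 K) K)] [MeasurableSpace (InfiniteAdeleRing K)] [BorelSpace (InfiniteAdeleRing K)]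
  [BorelSpace (FiniteAdeleRing (𝓞 K) K)] in
/-- `‖𝓕_fΦ_f(y)‖ ≤ ∫ ‖Φ_f‖` (`|ψ_f| = 1`). [cite: CasselsFrohlichANT1967, Ch. XV §3.2] -/
theorem norm_integral_mul_finiteAdeleAddChar_le (μ₂ : Measure (FiniteAdeleRing (𝓞 K) K)) (Φ₂ : FiniteAdeleRing (𝓞 K) K → ℂ) (y : FiniteAdeleRing (𝓞 K) K) :
    ‖∫ b, Φ₂ b * (finiteAdeleAddChar K (y * b) : ℂ) ∂μ₂‖ ≤ ∫ b, ‖Φ₂ b‖ ∂μ₂ := by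
  refine (norm_integral_le_integral_norm _).trans (le_of_eq (integral_congr_ae (Filter.Eventually.of_forall fun b => ?_)))
  simp only [norm_mul, Circle.norm_coe, mul_one]

/-! ## §3 Level ⟹ the finite transform is supported in a compact set depending on the level alone -/

omit [MeasurableSpace (AdeleRing (𝓞 K) K)] [BorelSpace (AdeleRing (𝓞 K) K)] [MeasurableSpace (InfiniteAdeleRing K)] [BorelSpace (InfiniteAdeleRing K)] in
/-- **TRANSLATION COVARIANCE**: if `Φ_f(b + l) = Φ_f(b)` for all `b` then `𝓕_fΦ_f(y) ≠ 0` forces `ψ_f(y l) = 1` (Haar invariance under `b ↦ b + l`).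
[cite: CasselsFrohlichANT1967, Ch. XV §2.2] -/
theorem finiteAdeleAddChar_eq_one_of_integral_ne_zero (μ₂ : Measure (FiniteAdeleRing (𝓞 K) K)) [μ₂.IsAddLeftInvariant] {Φ₂ : FiniteAdeleRing (𝓞 K) K → ℂ}
    {l : FiniteAdeleRing (𝓞 K) K} (hl : ∀ b, Φ₂ (b + l) = Φ₂ b) {y : FiniteAdeleRing (𝓞 K) K}
    (hy : ∫ b, Φ₂ b * (finiteAdeleAddChar K (y * b) : ℂ) ∂μ₂ ≠ 0) : finiteAdeleAddChar K (y * l) = 1 := by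
  have hcov : ∫ b, Φ₂ b * (finiteAdeleAddChar K (y * b) : ℂ) ∂μ₂ =
      (finiteAdeleAddChar K (y * l) : ℂ) * ∫ b, Φ₂ b * (finiteAdeleAddChar K (y * b) : ℂ) ∂μ₂ := by
    conv_lhs => rw [← integral_add_right_eq_self _ l]
    rw [← integral_const_mul]
    refine integral_congr_ae (Filter.Eventually.of_forall fun b => ?_)
    simp only [hl, mul_add, AddChar.map_add_eq_mul, Circle.coe_mul]
    ring
  have h1 : (1 - (finiteAdeleAddChar K (y * l) : ℂ)) * ∫ b, Φ₂ b * (finiteAdeleAddChar K (y * b) : ℂ) ∂μ₂ = 0 := by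
    rw [sub_mul, one_mul, ← hcov, sub_self]
  have h2 : (finiteAdeleAddChar K (y * l) : ℂ) = 1 := (sub_eq_zero.1 ((mul_eq_zero.1 h1).resolve_right hy)).symm
  exact Circle.coe_eq_one.1 h2

omit [MeasurableSpace (AdeleRing (𝓞 K) K)] [BorelSpace (AdeleRing (𝓞 K) K)] [MeasurableSpace (InfiniteAdeleRing K)] [BorelSpace (InfiniteAdeleRing K)] in
/-- **LEVEL ⟹ COMPACT SUPPORT OF THE FINITE TRANSFORM, uniformly over the level class**: for `𝔫 ≠ 0` there is a COMPACT `Cf ⊆ 𝔸_K^∞` such that for EVERY `Φ_f` with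
`Φ_f(b + l) = Φ_f(b)` (`l ∈ 𝔫𝒪̂_K`) and every additive left-invariant `μ₂`, `𝓕_fΦ_f(y) = 0` off `Cf` (★ `exists_denominator_annihilator_levelIdeal`: `ψ_f(y·𝔫𝒪̂_K) = 1 ⟹ D c y ∈ 𝒪̂_K`;
`Cf = (Dc)⁻¹ 𝒪̂_K`, compact by ★ `isCompact_integralFiniteAdeles`). [cite: CasselsFrohlichANT1967, Ch. XV §2.2 and §3.2] -/
theorem exists_isCompact_integral_mul_finiteAdeleAddChar_eq_zero {𝔫 : Ideal (𝓞 K)} (h𝔫 : 𝔫 ≠ 0) :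
    ∃ Cf : Set (FiniteAdeleRing (𝓞 K) K), IsCompact Cf ∧
      ∀ (μ₂ : Measure (FiniteAdeleRing (𝓞 K) K)) [μ₂.IsAddLeftInvariant] (Φ₂ : FiniteAdeleRing (𝓞 K) K → ℂ),
        (∀ b, ∀ l ∈ levelIdeal K 𝔫, Φ₂ (b + l) = Φ₂ b) →
        ∀ y : FiniteAdeleRing (𝓞 K) K, y ∉ Cf → ∫ b, Φ₂ b * (finiteAdeleAddChar K (y * b) : ℂ) ∂μ₂ = 0 := by
  classical
  obtain ⟨D, hD0, hD⟩ := exists_denominator_annihilator_levelIdeal K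
  obtain ⟨c, hc𝔫, hc0⟩ := Submodule.exists_mem_ne_zero_of_ne_bot (show 𝔫 ≠ ⊥ by rwa [Ne, ← Submodule.zero_eq_bot])
  have heK : ((D : K) * (c : K)) ≠ 0 := mul_ne_zero (by exact_mod_cast hD0) (by exact_mod_cast hc0)
  -- `Cf = (Dc)⁻¹ · 𝒪̂_K`
  refine ⟨(fun a : FiniteAdeleRing (𝓞 K) K => algebraMap K (FiniteAdeleRing (𝓞 K) K) ((D : K) * (c : K))⁻¹ * a) ''
      {a : FiniteAdeleRing (𝓞 K) K | ∀ v, a v ∈ v.adicCompletionIntegers K},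
    (isCompact_integralFiniteAdeles K).image (continuous_const.mul continuous_id), ?_⟩
  intro μ₂ _ Φ₂ hlev y hy
  by_contra hne
  apply hy
  -- every `l ∈ 𝔫𝒪̂_K` is annihilated by `ψ_f(y ·)`
  have hann : ∀ l ∈ levelIdeal K 𝔫, finiteAdeleAddChar K (y * l) = 1 := fun l hl =>
    finiteAdeleAddChar_eq_one_of_integral_ne_zero K μ₂ (fun b => hlev b l hl) hne
  have hint := hD 𝔫 h𝔫 c hc𝔫 y hann
  refine ⟨algebraMap K (FiniteAdeleRing (𝓞 K) K) ((D : K) * (c : K)) * y, hint, ?_⟩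
  simp only
  rw [← mul_assoc, ← map_mul, inv_mul_cancel₀ heK, map_one, one_mul]

/-! ## §4 The fibrewise form (head of record, ruling «R6d-FIBREWISE» 05:44Z): general `Φ`, Fubini over `𝔸_K^∞` -/

omit [BorelSpace (AdeleRing (𝓞 K) K)] in
/-- **`𝓕Φ(η) = c ∫_{𝔸_f} ψ_f(η_f b) · [∫_{K_∞} Φ(a, b) ψ((η_∞ a, 0)) dμ₁(a)] dμ₂(b)`** for `Φ` integrable on `μ₁ ⊗ μ₂` (§1 + ★ character split + Fubini `integral_prod_symm`).
[cite: CasselsFrohlichANT1967, Ch. XV §3.3] -/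
theorem integral_mul_adeleAddChar_eq_integral_fibre {μ : Measure (AdeleRing (𝓞 K) K)} {μ₁ : Measure (InfiniteAdeleRing K)} {μ₂ : Measure (FiniteAdeleRing (𝓞 K) K)}
    [SFinite μ₁] [SFinite μ₂] {c : ℝ≥0}
    (hc : ∀ G : InfiniteAdeleRing K → FiniteAdeleRing (𝓞 K) K → ℂ,
      ∫ v, G v.1 v.2 ∂μ = (c : ℝ) • ∫ p : InfiniteAdeleRing K × FiniteAdeleRing (𝓞 K) K, G p.1 p.2 ∂(μ₁.prod μ₂))
    {Φ : AdeleRing (𝓞 K) K → ℂ} (hΦi : Integrable (fun p : InfiniteAdeleRing K × FiniteAdeleRing (𝓞 K) K => Φ (p.1, p.2)) (μ₁.prod μ₂))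
    (η : AdeleRing (𝓞 K) K) :
    ∫ v, Φ v * (adeleAddChar K (η * v) : ℂ) ∂μ =
      (c : ℂ) * ∫ b, (∫ a, Φ (a, b) * (adeleAddChar K (infiniteAdeleInl K (η.1 * a)) : ℂ) ∂μ₁) * (finiteAdeleAddChar K (η.2 * b) : ℂ) ∂μ₂ := by
  haveI := secondCountableTopology_finiteAdeleRing K
  haveI := secondCountableTopology_infiniteAdeleRing K
  haveI : BorelSpace (InfiniteAdeleRing K × FiniteAdeleRing (𝓞 K) K) := Prod.borelSpace
  have hmul1 : ∀ v : AdeleRing (𝓞 K) K, (η * v).1 = η.1 * v.1 := fun v => rfl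
  have hmul2 : ∀ v : AdeleRing (𝓞 K) K, (η * v).2 = η.2 * v.2 := fun v => rfl
  have hΦv : ∀ v : AdeleRing (𝓞 K) K, Φ v = Φ (v.1, v.2) := fun v => rfl
  have hint : ∀ v : AdeleRing (𝓞 K) K, Φ v * (adeleAddChar K (η * v) : ℂ) =
      Φ (v.1, v.2) * (adeleAddChar K (infiniteAdeleInl K (η.1 * v.1)) : ℂ) * (finiteAdeleAddChar K (η.2 * v.2) : ℂ) := by
    intro v
    rw [adeleAddChar_eq_mul K (η * v), Circle.coe_mul, hmul1, hmul2, ← hΦv, mul_assoc]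
  simp_rw [hint]
  have h := hc (fun a b => Φ (a, b) * (adeleAddChar K (infiniteAdeleInl K (η.1 * a)) : ℂ) * (finiteAdeleAddChar K (η.2 * b) : ℂ))
  rw [h, Complex.real_smul]
  congr 1
  -- Fubini, outer integral over the finite variable
  have hF : Integrable (fun p : InfiniteAdeleRing K × FiniteAdeleRing (𝓞 K) K =>
      Φ (p.1, p.2) * (adeleAddChar K (infiniteAdeleInl K (η.1 * p.1)) : ℂ) * (finiteAdeleAddChar K (η.2 * p.2) : ℂ)) (μ₁.prod μ₂) := by
    refine (hΦi.mul_bdd (c := 1) ?_ (ae_of_all _ fun p => by rw [Circle.norm_coe])).mul_bdd (c := 1) ?_ (ae_of_all _ fun p => by rw [Circle.norm_coe])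
    · exact (continuous_subtype_val.comp ((continuous_adeleAddChar K).comp ((continuous_infiniteAdeleInl K).comp (continuous_const.mul continuous_fst)))).aestronglyMeasurable
    · exact (continuous_subtype_val.comp ((continuous_finiteAdeleAddChar K).comp (continuous_const.mul continuous_snd))).aestronglyMeasurable
  rw [integral_prod_symm _ hF]
  refine integral_congr_ae (Filter.Eventually.of_forall fun b => ?_)
  simp only
  rw [← integral_mul_const]

/-- **THE ENVELOPE THEOREM, FIBREWISE** (head of record; see the module docstring): `∃ c > 0` (measures only) and, for each level `𝔫 ≠ 0`, `∃ Cf` compact (level only) such that for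
every `Φ : 𝔸_K → ℂ`, integrable on `μ₁ ⊗ μ₂` (`integrable_iff_integrable_prod`), level-`𝔫` periodic in the finite variable, with FIBREWISE archimedean Fourier decay
`‖∫ Φ(a, b) ψ((y a, 0)) dμ₁(a)‖ ≤ A(b) (1 + ‖y‖)^{-m}`, `A ∈ L¹(μ₂)`, `∫ A ≤ N₂`: the adelic transform `Ψ(η) = ∫ Φ(v) ψ(η v) dμ(v)` satisfies
`‖Ψ η‖ ≤ (c N₂) (1 + ‖η_∞‖)^{-m}` and `Ψ η = 0` for `η_f ∉ Cf` — the binders `hM`, `hCf` of ★ `K2E1AdelicFourierDecay.exists_forall_tsum_indicator_norm_mul_le_rpow_neg`.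
[cite: CasselsFrohlichANT1967, Ch. XV §3.2–3.3] [cite: MoeglinWaldspurger1995, II.1.10] -/
theorem exists_envelope (μ : Measure (AdeleRing (𝓞 K) K)) [μ.IsAddHaarMeasure]
    (μ₁ : Measure (InfiniteAdeleRing K)) [μ₁.IsAddHaarMeasure] (μ₂ : Measure (FiniteAdeleRing (𝓞 K) K)) [μ₂.IsAddHaarMeasure]
    {𝔫 : Ideal (𝓞 K)} (h𝔫 : 𝔫 ≠ 0) :
    ∃ c : ℝ, 0 < c ∧ ∃ Cf : Set (FiniteAdeleRing (𝓞 K) K), IsCompact Cf ∧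
      ∀ (Φ : AdeleRing (𝓞 K) K → ℂ) (A : FiniteAdeleRing (𝓞 K) K → ℝ) (N₂ : ℝ) (m : ℕ),
        Integrable (fun p : InfiniteAdeleRing K × FiniteAdeleRing (𝓞 K) K => Φ (p.1, p.2)) (μ₁.prod μ₂) →
        (∀ (a : InfiniteAdeleRing K) (b : FiniteAdeleRing (𝓞 K) K), ∀ l ∈ levelIdeal K 𝔫, Φ (a, b + l) = Φ (a, b)) →
        (∀ (b : FiniteAdeleRing (𝓞 K) K) (y : InfiniteAdeleRing K), ‖∫ a, Φ (a, b) * (adeleAddChar K (infiniteAdeleInl K (y * a)) : ℂ) ∂μ₁‖ ≤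
          A b * (1 + ‖InfiniteAdeleRing.ringEquiv_mixedSpace K y‖) ^ (-(m : ℝ))) →
        Integrable A μ₂ → (∫ b, A b ∂μ₂ ≤ N₂) →
        (∀ η : AdeleRing (𝓞 K) K, ‖∫ v, Φ v * (adeleAddChar K (η * v) : ℂ) ∂μ‖ ≤ (c * N₂) * (1 + ‖InfiniteAdeleRing.ringEquiv_mixedSpace K η.1‖) ^ (-(m : ℝ))) ∧
        (∀ η : AdeleRing (𝓞 K) K, η.2 ∉ Cf → ∫ v, Φ v * (adeleAddChar K (η * v) : ℂ) ∂μ = 0) := by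
  haveI := secondCountableTopology_adeleRing K
  haveI := locallyCompactSpace_adeleRing' K
  haveI := secondCountableTopology_finiteAdeleRing K
  haveI := locallyCompactSpace_finiteAdeleRing' K
  haveI := secondCountableTopology_infiniteAdeleRing K
  obtain ⟨c, hc0, hc⟩ := exists_integral_adele_eq_smul_integral_prod K μ μ₁ μ₂
  obtain ⟨Cf, hCfc, hCf⟩ := exists_isCompact_integral_mul_finiteAdeleAddChar_eq_zero K h𝔫
  refine ⟨c, NNReal.coe_pos.2 hc0, Cf, hCfc, fun Φ A N₂ m hΦi hlev hdec hAi hAN => ⟨fun η => ?_, fun η hη => ?_⟩⟩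
  · rw [integral_mul_adeleAddChar_eq_integral_fibre K hc hΦi η, norm_mul, Complex.norm_real, NNReal.norm_eq]
    set w : ℝ := (1 + ‖InfiniteAdeleRing.ringEquiv_mixedSpace K η.1‖) ^ (-(m : ℝ)) with hw
    have hw0 : 0 ≤ w := Real.rpow_nonneg (by positivity) _
    have hbound : ∀ b : FiniteAdeleRing (𝓞 K) K,
        ‖(∫ a, Φ (a, b) * (adeleAddChar K (infiniteAdeleInl K (η.1 * a)) : ℂ) ∂μ₁) * (finiteAdeleAddChar K (η.2 * b) : ℂ)‖ ≤ A b * w := fun b => by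
      rw [norm_mul, Circle.norm_coe, mul_one]
      exact hdec b η.1
    have hI := norm_integral_le_of_norm_le (hAi.mul_const w) (ae_of_all _ hbound)
    rw [integral_mul_const] at hI
    calc (c : ℝ) * ‖∫ b, (∫ a, Φ (a, b) * (adeleAddChar K (infiniteAdeleInl K (η.1 * a)) : ℂ) ∂μ₁) * (finiteAdeleAddChar K (η.2 * b) : ℂ) ∂μ₂‖
        ≤ (c : ℝ) * ((∫ b, A b ∂μ₂) * w) := mul_le_mul_of_nonneg_left hI (NNReal.coe_nonneg c)
      _ ≤ (c : ℝ) * (N₂ * w) := mul_le_mul_of_nonneg_left (mul_le_mul_of_nonneg_right hAN hw0) (NNReal.coe_nonneg c)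
      _ = (c : ℝ) * N₂ * w := (mul_assoc _ _ _).symm
  · rw [integral_mul_adeleAddChar_eq_integral_fibre K hc hΦi η]
    rw [hCf μ₂ (fun b => ∫ a, Φ (a, b) * (adeleAddChar K (infiniteAdeleInl K (η.1 * a)) : ℂ) ∂μ₁) (fun b l hl => by simp_rw [hlev _ b l hl]) η.2 hη,
      mul_zero]

/-! ## §5 Assembly: the two binders of ★ `K2E1AdelicFourierDecay` (E2) for tensors of a fixed level -/

/-- **THE ENVELOPE THEOREM** (see the module docstring): `∃ c > 0` (measures only) and, for each level `𝔫 ≠ 0`, `∃ Cf` compact (level only) such that for all tensors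
`Φ = Φ₁ ⊗ Φ₂` with `∫‖Φ₂‖ ≤ N₂`, `Φ₂` of level `𝔫`, and archimedean Fourier decay `‖𝓕_∞Φ₁(y)‖ ≤ A (1 + ‖y‖)^{-m}`, the adelic transform `Ψ(η) = ∫ Φ(v) ψ(η v) dμ(v)`
satisfies `‖Ψ η‖ ≤ (c A N₂) (1 + ‖η_∞‖)^{-m}` and `Ψ η = 0` for `η_f ∉ Cf` — the binders `hM`, `hCf` of ★ `K2E1AdelicFourierDecay.exists_forall_tsum_indicator_norm_mul_le_rpow_neg`,
constants uniform over the class. [cite: CasselsFrohlichANT1967, Ch. XV §3.2–3.3] [cite: MoeglinWaldspurger1995, II.1.10] -/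
theorem exists_envelope_of_tensor (μ : Measure (AdeleRing (𝓞 K) K)) [μ.IsAddHaarMeasure]
    (μ₁ : Measure (InfiniteAdeleRing K)) [μ₁.IsAddHaarMeasure] (μ₂ : Measure (FiniteAdeleRing (𝓞 K) K)) [μ₂.IsAddHaarMeasure]
    {𝔫 : Ideal (𝓞 K)} (h𝔫 : 𝔫 ≠ 0) :
    ∃ c : ℝ, 0 < c ∧ ∃ Cf : Set (FiniteAdeleRing (𝓞 K) K), IsCompact Cf ∧
      ∀ (Φ : AdeleRing (𝓞 K) K → ℂ) (Φ₁ : InfiniteAdeleRing K → ℂ) (Φ₂ : FiniteAdeleRing (𝓞 K) K → ℂ) (A N₂ : ℝ) (m : ℕ),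
        (∀ v, Φ v = Φ₁ v.1 * Φ₂ v.2) →
        (∫ b, ‖Φ₂ b‖ ∂μ₂ ≤ N₂) →
        (∀ b, ∀ l ∈ levelIdeal K 𝔫, Φ₂ (b + l) = Φ₂ b) →
        (∀ y : InfiniteAdeleRing K, ‖∫ a, Φ₁ a * (adeleAddChar K (infiniteAdeleInl K (y * a)) : ℂ) ∂μ₁‖ ≤
          A * (1 + ‖InfiniteAdeleRing.ringEquiv_mixedSpace K y‖) ^ (-(m : ℝ))) →
        (∀ η : AdeleRing (𝓞 K) K, ‖∫ v, Φ v * (adeleAddChar K (η * v) : ℂ) ∂μ‖ ≤ (c * A * N₂) * (1 + ‖InfiniteAdeleRing.ringEquiv_mixedSpace K η.1‖) ^ (-(m : ℝ))) ∧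
        (∀ η : AdeleRing (𝓞 K) K, η.2 ∉ Cf → ∫ v, Φ v * (adeleAddChar K (η * v) : ℂ) ∂μ = 0) := by
  haveI := secondCountableTopology_adeleRing K
  haveI := locallyCompactSpace_adeleRing' K
  haveI := secondCountableTopology_finiteAdeleRing K
  haveI := locallyCompactSpace_finiteAdeleRing' K
  haveI := secondCountableTopology_infiniteAdeleRing K
  obtain ⟨c, hc0, hc⟩ := exists_integral_adele_eq_smul_integral_prod K μ μ₁ μ₂
  obtain ⟨Cf, hCfc, hCf⟩ := exists_isCompact_integral_mul_finiteAdeleAddChar_eq_zero K h𝔫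
  refine ⟨c, NNReal.coe_pos.2 hc0, Cf, hCfc, fun Φ Φ₁ Φ₂ A N₂ m hΦ hN₂ hlev hdec => ⟨fun η => ?_, fun η hη => ?_⟩⟩
  · rw [integral_tensor_mul_adeleAddChar_eq K hc hΦ η, norm_mul, norm_mul, Complex.norm_real, NNReal.norm_eq]
    have hF := hdec η.1
    have hG := (norm_integral_mul_finiteAdeleAddChar_le K μ₂ Φ₂ η.2).trans hN₂
    have hw : 0 ≤ A * (1 + ‖InfiniteAdeleRing.ringEquiv_mixedSpace K η.1‖) ^ (-(m : ℝ)) := (norm_nonneg _).trans hF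
    calc (c : ℝ) * ‖∫ a, Φ₁ a * (adeleAddChar K (infiniteAdeleInl K (η.1 * a)) : ℂ) ∂μ₁‖ * ‖∫ b, Φ₂ b * (finiteAdeleAddChar K (η.2 * b) : ℂ) ∂μ₂‖
        ≤ (c : ℝ) * (A * (1 + ‖InfiniteAdeleRing.ringEquiv_mixedSpace K η.1‖) ^ (-(m : ℝ))) * N₂ :=
          mul_le_mul (mul_le_mul_of_nonneg_left hF (NNReal.coe_nonneg c)) hG (norm_nonneg _) (mul_nonneg (NNReal.coe_nonneg c) hw)
      _ = (c : ℝ) * A * N₂ * (1 + ‖InfiniteAdeleRing.ringEquiv_mixedSpace K η.1‖) ^ (-(m : ℝ)) := by ring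
  · rw [integral_tensor_mul_adeleAddChar_eq K hc hΦ η, hCf μ₂ Φ₂ hlev η.2 hη, mul_zero]

end Summit.HodgeConjecture.HodgeConjecture.Cruxes.H413.K2E1AdelicFourierEnvelope

end
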